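import Summits.AtomisticToContinuum.Crystallization.Theorems.ExcessDecayLiouvilleStepGradient
import Summits.AtomisticToContinuum.Crystallization.Theorems.ExcessDecayLiouvilleCurrenciesNN
import Summits.AtomisticToContinuum.Crystallization.Theorems.ExcessDecayLiouvilleCutoff

/-!
# Route `ExcessDecayLiouville`: the global gradient bound of the step field (nonlinear half, XXIX)

Harmonic-replacement architecture for item `ExcessDecay` (stmt-AtomisticToContinuum-9334), nonlinear half.
The dyadic gradient currency uses, beyond the radius `r/32` about `c₀`, a global bound `NN_tot` of the
nearest-neighbour form of the step field `v = χ·ũ` (`χ = 1` on `B_{r/2}(c)`, `0` beyond `3r/4`, Lipschitz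
`1/w`).  Ingredients:
* `step_forcing_gen` : the forcing bound of `step_forcing` with general radii (for the auxiliary cut-off
  `χ'`, `= 1` on `B_{7r/8}(c)`);
* `NN_le_NN_of_support` : `NN[v, c₀, X] ≤ NN[v, c, R]` when `v` vanishes at the sites beyond `R − 11/10` from `c`;
* `NN_smul_split` : `NN[χ·ũ, c, R] ≤ 2·40·(11/10)²/w² Σ_{sites of B_R(c)} ‖ũ‖² + 2 NN[ũ, c, R]`.
The assembly with `step_gradient` at the auxiliary cut-off is left to the caller (`global_gradient` in the
scale induction).
All `[folklore]`; helper lemmas, nothing here closes an item.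
-/

noncomputable section

namespace Summit.AtomisticToContinuum.Crystallization.Theorems.ExcessDecayLiouville

open scoped BigOperators Topology InnerProductSpace RealInnerProductSpace Classical
open Literature.MathematicalPhysics.StatisticalMechanics
open Summit.AtomisticToContinuum.Crystallization.Theorems.PhononStabilityNegative

-- Local notation: the force-constant map `K(e)w = h(|e|²)w + 2⟪e,w⟫h′(|e|²)e`.
local notation3 "𝕂[" e "] " w:max =>
  (-((‖e‖ ^ 2)⁻¹) ^ 7 + ((‖e‖ ^ 2)⁻¹) ^ 4) • w + (2 * ⟪e, w⟫ * (7 * ((‖e‖ ^ 2)⁻¹) ^ 8 - 4 * ((‖e‖ ^ 2)⁻¹) ^ 5)) • e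
-- Local notation: the pair force `F(x) = h(|x|²) x`.
local notation3 "𝐅[" x "]" => ((-((‖x‖ ^ 2)⁻¹) ^ 7 + ((‖x‖ ^ 2)⁻¹) ^ 4) • x)

section

variable {X : Set (EuclideanSpace ℝ (Fin 3))} {c : EuclideanSpace ℝ (Fin 3)} {r ε δ : ℝ}
  {t : Fin 2 → EuclideanSpace ℝ (Fin 3)} {A : EuclideanSpace ℝ (Fin 3) →L[ℝ] EuclideanSpace ℝ (Fin 3)}
  {π : EuclideanSpace ℝ (Fin 3) → EuclideanSpace ℝ (Fin 3)}
  {aff : (EuclideanSpace ℝ (Fin 3)) → (EuclideanSpace ℝ (Fin 3))} {a : Fin 2 → EuclideanSpace ℝ (Fin 3)}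
  {B : (EuclideanSpace ℝ (Fin 3)) →L[ℝ] (EuclideanSpace ℝ (Fin 3))} {x₀ : EuclideanSpace ℝ (Fin 3)}

/-- **The forcing bound with general radii**: `χ = 1` on the sites of `B_{Rone}(c)`, the site `p` at
`dist p c ≤ dmax` with `dmax + ϱ₁ ≤ Rone` (`ϱ₁ ≥ 23/25`), depth `r − dmax − 2ε ≥ max(1, δ)`. [folklore] -/
theorem step_forcing_gen (hA : Adm₀ A) (hI : Inner₀ t A) (hX : X.Finite) (hsep : Sep₀ X δ) (hδ : 0 < δ)
    (hε0 : 0 ≤ ε) (hε : 2 * ε < δ)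
    (hXb : ∀ p ∈ X, dist p c ≤ r → ∃ m : Fin 2, ∃ z ∈ Λ₀, dist p (t m + A z) ≤ ε)
    (hπ : ∀ s' ∈ Sites₀ t A, dist s' c ≤ r → π s' ∈ X ∧ dist (π s') s' ≤ ε)
    (haff : ∀ (m : Fin 2) (z : EuclideanSpace ℝ (Fin 3)), z ∈ Λ₀ → aff (t m + A z) = a m + B (t m + A z - x₀))
    (ha : ‖a 0 - a 1‖ ≤ 1 / 50) (hB : ‖B‖ ≤ 1 / 50)
    (hrelax : ∀ s : Sites₀ t A, (∑' q : Sites₀ t A, (if (s : EuclideanSpace ℝ (Fin 3)) ≠ q then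
        𝐅[((s : EuclideanSpace ℝ (Fin 3)) - q) + (aff s - aff q)] else 0)) = 0)
    (SR : Finset (EuclideanSpace ℝ (Fin 3))) (hSR : ∀ x, x ∈ SR ↔ x ∈ Sites₀ t A ∧ dist x c ≤ r)
    (χ : EuclideanSpace ℝ (Fin 3) → ℝ) (hχ1 : ∀ x, |1 - χ x| ≤ 1)
    {Rone dmax ϱ₁ : ℝ} (hχone : ∀ q ∈ SR, dist q c ≤ Rone → χ q = 1) (hϱ₁ : 23 / 25 ≤ ϱ₁) (hR1 : dmax + ϱ₁ ≤ Rone)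
    (hdepth1 : 1 ≤ r - dmax - 2 * ε) (hdepthδ : δ ≤ r - dmax - 2 * ε)
    {D : ℝ} (hD : 0 ≤ D) (hDb : ∀ x ∈ SR, ‖(π x - x) - aff x‖ ≤ D)
    (p : Sites₀ t A) (hp : (p : EuclideanSpace ℝ (Fin 3)) ∈ SR) (hpc : dist (p : EuclideanSpace ℝ (Fin 3)) c ≤ dmax) :
    ‖(fun s : EuclideanSpace ℝ (Fin 3) =>
          (-(∑ s' ∈ SR.erase s, 𝐅[(s - s') + (aff s - aff s')]) -
            (∑ q ∈ (hX.toFinset.erase (π s)) \ ((SR.erase s).image π),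
              (deriv lennardJones (dist (π s) q) / dist (π s) q) • (π s - q)) +
            ((∑ s' ∈ SR.erase s, 𝕂[s - s'] ((1 - χ s') • ((π s' - s') - aff s'))) +
              ∑' q : ↑((SR.subtype (· ∈ Sites₀ t A) : Set (Sites₀ t A)))ᶜ,
                (if s ≠ (q : EuclideanSpace ℝ (Fin 3)) then 𝕂[s - (q : EuclideanSpace ℝ (Fin 3))] ((π s - s) - aff s) else 0)))) p‖ ≤
      31488 * (1024 / ((23 / 25 : ℝ) ^ 3 * (r - dmax) ^ 4)) + 2048 / (δ ^ 3 * (r - dmax - 2 * ε) ^ 4) +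
        (38 * D * (1024 / ((23 / 25 : ℝ) ^ 3 * ϱ₁ ^ 5)) + 38 * D * (1024 / ((23 / 25 : ℝ) ^ 3 * (r - dmax) ^ 5))) := by
  have hpS : (p : EuclideanSpace ℝ (Fin 3)) ∈ Sites₀ t A := p.2
  have hdmax : dist (p : EuclideanSpace ℝ (Fin 3)) c ≤ dmax := hpc
  have hpr : dist (p : EuclideanSpace ℝ (Fin 3)) c ≤ r := by linarith
  have hrd : 1 ≤ r - dmax := by linarith
  have hSRS : ∀ x ∈ SR, x ∈ Sites₀ t A := fun x hx => ((hSR x).1 hx).1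
  -- (1) truncated self-force
  have h1 := norm_selfForce_trunc_le hA hI haff ha hB p (by linarith) SR hSR (hrelax p) (c := c)
  have h1' : 31488 * (1024 / ((23 / 25 : ℝ) ^ 3 * (r - dist (p : EuclideanSpace ℝ (Fin 3)) c) ^ 4)) ≤
      31488 * (1024 / ((23 / 25 : ℝ) ^ 3 * (r - dmax) ^ 4)) := by
    have hge : r - dmax ≤ r - dist (p : EuclideanSpace ℝ (Fin 3)) c := by linarith
    have h0 : 0 < r - dmax := by linarith
    gcongr
  -- (2) unmatched particles
  have hRest : ∀ q ∈ (hX.toFinset.erase (π p)) \ ((SR.erase p).image π), ∀ s' ∈ Sites₀ t A, dist s' c ≤ r → π s' ≠ q := by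
    intro q hq s' hs' hs'c heq
    rw [Finset.mem_sdiff, Finset.mem_erase, Finset.mem_image] at hq
    obtain ⟨⟨hqne, -⟩, hnot⟩ := hq
    refine hnot ⟨s', Finset.mem_erase.2 ⟨?_, (hSR s').2 ⟨hs', hs'c⟩⟩, heq⟩
    intro h; rw [h] at heq; exact hqne heq.symm
  have hRestX : ∀ q ∈ (hX.toFinset.erase (π p)) \ ((SR.erase p).image π), q ∈ X := fun q hq => by
    rw [Finset.mem_sdiff, Finset.mem_erase, Set.Finite.mem_toFinset] at hq; exact hq.1.2
  have h2 := sum_norm_rest_le hsep hδ hε0 hε hXb hπ hpS hpr (by linarith) (by linarith) _ hRestX hRest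
  have h2' : 2048 / (δ ^ 3 * (r - dist (p : EuclideanSpace ℝ (Fin 3)) c - 2 * ε) ^ 4) ≤ 2048 / (δ ^ 3 * (r - dmax - 2 * ε) ^ 4) := by
    have hge : r - dmax - 2 * ε ≤ r - dist (p : EuclideanSpace ℝ (Fin 3)) c - 2 * ε := by linarith
    have h0 : 0 < r - dmax - 2 * ε := by linarith
    gcongr
  have h2n : ‖∑ q ∈ (hX.toFinset.erase (π p)) \ ((SR.erase p).image π),
      (deriv lennardJones (dist (π p) q) / dist (π p) q) • (π p - q)‖ ≤ 2048 / (δ ^ 3 * (r - dmax - 2 * ε) ^ 4) :=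
    (norm_sum_le _ _).trans (h2.trans h2')
  -- (3) the cut-off tails
  have h3 := norm_cutoffTail_le hA hI hpS SR hSRS χ hχ1 (ϱ := ϱ₁) hϱ₁ hD
    (fun q hq hdq => hχone q hq (by
      have := dist_triangle q (p : EuclideanSpace ℝ (Fin 3)) c
      rw [dist_comm q (p : EuclideanSpace ℝ (Fin 3))] at this; linarith))
    (fun x => (π x - x) - aff x) hDb
  have h4 := norm_tsum_compl_le hA hI hpS (ϱ := r - dmax) (by linarith) (by linarith) SR hSR ((π p - p) - aff p) (c := c)
  have h4' : 38 * ‖(π p - p) - aff p‖ * (1024 / ((23 / 25 : ℝ) ^ 3 * (r - dmax) ^ 5)) ≤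
      38 * D * (1024 / ((23 / 25 : ℝ) ^ 3 * (r - dmax) ^ 5)) := by
    have := hDb p hp
    have h0 : 0 < r - dmax := by linarith
    gcongr
  -- assemble
  simp only []
  refine (norm_combo_le _ _ _ _).trans ?_
  linarith [h1.trans h1', h2n, h3, h4.trans h4']

end

section

variable {t : Fin 2 → (EuclideanSpace ℝ (Fin 3))} {A : (EuclideanSpace ℝ (Fin 3)) →L[ℝ] (EuclideanSpace ℝ (Fin 3))}

variable (hA : Adm₀ A) (hI : Inner₀ t A)

set_option quotPrecheck false in
-- Local notation: the finite near-neighbour form on the ball of radius `X` about the centre `cc`.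
local notation "NN[" v ", " cc ", " X "]" =>
  (∑ p ∈ (finite_sites_dist_le (t := t) (A := A) hA hI cc X).toFinset,
    ∑ q ∈ (finite_sites_dist_le (t := t) (A := A) hA hI cc X).toFinset,
      (if p ≠ q ∧ dist p q ≤ 11 / 10 then ‖v p - v q‖ ^ 2 else (0 : ℝ)))

include hA hI in
/-- **Change of centre and radius under a support condition**: if `v` vanishes at every site farther than
`R − 11/10` from `c`, then `NN[v, c₀, X] ≤ NN[v, c, R]`. [folklore] -/
theorem NN_le_NN_of_support (v : (EuclideanSpace ℝ (Fin 3)) → (EuclideanSpace ℝ (Fin 3)))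
    (c₀ c : EuclideanSpace ℝ (Fin 3)) {X R : ℝ}
    (hsupp : ∀ x ∈ Sites₀ t A, R - 11 / 10 < dist x c → v x = 0) :
    NN[v, c₀, X] ≤ NN[v, c, R] := by
  classical
  set F₁ := (finite_sites_dist_le (t := t) (A := A) hA hI c₀ X).toFinset with hF₁
  set F₂ := (finite_sites_dist_le (t := t) (A := A) hA hI c R).toFinset with hF₂
  have hmem₁ : ∀ x ∈ F₁, x ∈ Sites₀ t A := fun x hx => by
    have h := (Set.Finite.mem_toFinset (finite_sites_dist_le (t := t) (A := A) hA hI c₀ X)).1 hx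
    exact h.1
  have hmem₂ : ∀ x, x ∈ F₂ ↔ x ∈ Sites₀ t A ∧ dist x c ≤ R := fun x => by
    rw [hF₂, Set.Finite.mem_toFinset]; rfl
  -- a nonzero pair term forces both points into F₂
  have hkey : ∀ p ∈ F₁, ∀ q ∈ F₁, (if p ≠ q ∧ dist p q ≤ 11 / 10 then ‖v p - v q‖ ^ 2 else (0 : ℝ)) ≠ 0 → p ∈ F₂ ∧ q ∈ F₂ := by
    intro p hp q hq hne
    by_cases h : p ≠ q ∧ dist p q ≤ 11 / 10
    · rw [if_pos h] at hne
      have hvne : v p - v q ≠ 0 := by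
        intro h0; apply hne; rw [h0, norm_zero]; ring
      have hpS := hmem₁ p hp
      have hqS := hmem₁ q hq
      -- one of v p, v q is nonzero
      have hor : dist p c ≤ R - 11 / 10 ∨ dist q c ≤ R - 11 / 10 := by
        by_contra hh
        push Not at hh
        apply hvne
        rw [hsupp p hpS hh.1, hsupp q hqS hh.2, sub_zero]
      rcases hor with hpc | hqc
      · refine ⟨(hmem₂ p).2 ⟨hpS, by linarith⟩, (hmem₂ q).2 ⟨hqS, ?_⟩⟩
        have := dist_triangle q p c; rw [dist_comm q p] at this; linarith [h.2]
      · refine ⟨(hmem₂ p).2 ⟨hpS, ?_⟩, (hmem₂ q).2 ⟨hqS, by linarith⟩⟩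
        have := dist_triangle p q c; linarith [h.2]
    · exact absurd (if_neg h) hne
  -- restrict to F₁ ∩ F₂, then enlarge to F₂
  have hnn : ∀ p q : EuclideanSpace ℝ (Fin 3), (0 : ℝ) ≤ (if p ≠ q ∧ dist p q ≤ 11 / 10 then ‖v p - v q‖ ^ 2 else 0) :=
    fun p q => by positivity
  calc NN[v, c₀, X] = ∑ p ∈ F₁ ∩ F₂, ∑ q ∈ F₁, (if p ≠ q ∧ dist p q ≤ 11 / 10 then ‖v p - v q‖ ^ 2 else (0 : ℝ)) := by
        symm
        refine Finset.sum_subset Finset.inter_subset_left fun p hp hpn => ?_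
        refine Finset.sum_eq_zero fun q hq => ?_
        by_contra hne
        exact hpn (Finset.mem_inter.2 ⟨hp, (hkey p hp q hq hne).1⟩)
    _ = ∑ p ∈ F₁ ∩ F₂, ∑ q ∈ F₁ ∩ F₂, (if p ≠ q ∧ dist p q ≤ 11 / 10 then ‖v p - v q‖ ^ 2 else (0 : ℝ)) := by
        refine Finset.sum_congr rfl fun p hp => ?_
        symm
        refine Finset.sum_subset Finset.inter_subset_left fun q hq hqn => ?_
        by_contra hne
        exact hqn (Finset.mem_inter.2 ⟨hq, (hkey p (Finset.mem_inter.1 hp).1 q hq hne).2⟩)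
    _ ≤ ∑ p ∈ F₂, ∑ q ∈ F₂, (if p ≠ q ∧ dist p q ≤ 11 / 10 then ‖v p - v q‖ ^ 2 else (0 : ℝ)) := by
        refine (Finset.sum_le_sum_of_subset_of_nonneg Finset.inter_subset_right fun p _ _ =>
          Finset.sum_nonneg fun q _ => hnn p q).trans ?_
        exact Finset.sum_le_sum fun p _ => Finset.sum_le_sum_of_subset_of_nonneg Finset.inter_subset_right fun q _ _ => hnn p q

include hA hI in
/-- **Splitting a cut-off out of the nearest-neighbour form**: for `|χ| ≤ 1` with `|χ p − χ q| ≤ ‖p − q‖/w` on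
the sites, `NN[χ·ũ, c, R] ≤ 2·(40·((11/10)/w)²) Σ_{sites of B_R(c)} ‖ũ‖² + 2 NN[ũ, c, R]`. [folklore] -/
theorem NN_smul_split (u : (EuclideanSpace ℝ (Fin 3)) → (EuclideanSpace ℝ (Fin 3))) (χ : (EuclideanSpace ℝ (Fin 3)) → ℝ)
    (hχabs : ∀ x, |χ x| ≤ 1) {w : ℝ} (hw : 0 < w)
    (hlip : ∀ p q : Sites₀ t A, |χ p - χ q| ≤ ‖(p : EuclideanSpace ℝ (Fin 3)) - q‖ / w)
    (c : EuclideanSpace ℝ (Fin 3)) (R : ℝ) :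
    NN[(fun x => χ x • u x), c, R] ≤
      2 * (40 * ((11 / 10) / w) ^ 2) * ∑ p ∈ (finite_sites_dist_le (t := t) (A := A) hA hI c R).toFinset, ‖u p‖ ^ 2 +
        2 * NN[u, c, R] := by
  classical
  set F := (finite_sites_dist_le (t := t) (A := A) hA hI c R).toFinset with hF
  have hmemF : ∀ x ∈ F, x ∈ Sites₀ t A ∧ dist x c ≤ R := fun x hx => by
    have h := (Set.Finite.mem_toFinset (finite_sites_dist_le (t := t) (A := A) hA hI c R)).1 hx
    exact h
  -- pointwise
  have hpt : ∀ p ∈ F, ∀ q ∈ F, (if p ≠ q ∧ dist p q ≤ 11 / 10 then ‖(fun x => χ x • u x) p - (fun x => χ x • u x) q‖ ^ 2 else (0 : ℝ)) ≤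
      2 * ((11 / 10) / w) ^ 2 * ((if p ≠ q ∧ dist p q ≤ 11 / 10 then (1 : ℝ) else 0) * ‖u p‖ ^ 2) +
      2 * (if p ≠ q ∧ dist p q ≤ 11 / 10 then ‖u p - u q‖ ^ 2 else (0 : ℝ)) := by
    intro p hp q hq
    by_cases h : p ≠ q ∧ dist p q ≤ 11 / 10
    · rw [if_pos h, if_pos h, if_pos h, one_mul]
      simp only []
      have hsplit : χ p • u p - χ q • u q = (χ p - χ q) • u p + χ q • (u p - u q) := by
        rw [sub_smul, smul_sub]; abel
      rw [hsplit]
      have hn := norm_add_le ((χ p - χ q) • u p) (χ q • (u p - u q))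
      rw [norm_smul, norm_smul, Real.norm_eq_abs, Real.norm_eq_abs] at hn
      have hl : |χ p - χ q| ≤ (11 / 10) / w := by
        have := hlip ⟨p, (hmemF p hp).1⟩ ⟨q, (hmemF q hq).1⟩
        simp only [] at this
        rw [← dist_eq_norm] at this
        exact this.trans (div_le_div_of_nonneg_right h.2 hw.le)
      have hq1 := hχabs q
      have h0 : 0 ≤ |χ p - χ q| := abs_nonneg _
      have h1 : 0 ≤ |χ q| := abs_nonneg _
      have hup : 0 ≤ ‖u p‖ := norm_nonneg _
      have hupq : 0 ≤ ‖u p - u q‖ := norm_nonneg _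
      have hA1 : |χ p - χ q| * ‖u p‖ ≤ (11 / 10) / w * ‖u p‖ := mul_le_mul_of_nonneg_right hl hup
      have hB1 : |χ q| * ‖u p - u q‖ ≤ 1 * ‖u p - u q‖ := mul_le_mul_of_nonneg_right hq1 hupq
      have hsum : ‖(χ p - χ q) • u p + χ q • (u p - u q)‖ ≤ (11 / 10) / w * ‖u p‖ + ‖u p - u q‖ := by linarith
      have hpos : 0 ≤ (11 / 10) / w * ‖u p‖ := by positivity
      calc ‖(χ p - χ q) • u p + χ q • (u p - u q)‖ ^ 2 ≤ ((11 / 10) / w * ‖u p‖ + ‖u p - u q‖) ^ 2 :=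
            pow_le_pow_left₀ (norm_nonneg _) hsum 2
        _ ≤ 2 * ((11 / 10) / w) ^ 2 * ‖u p‖ ^ 2 + 2 * ‖u p - u q‖ ^ 2 := by
            nlinarith [sq_nonneg ((11 / 10) / w * ‖u p‖ - ‖u p - u q‖)]
        _ = _ := by ring
    · rw [if_neg h, if_neg h, if_neg h]; simp
  -- sum
  have hcount : ∀ p ∈ F, (∑ q ∈ F, (if p ≠ q ∧ dist p q ≤ 11 / 10 then (1 : ℝ) else 0)) ≤ 40 := by
    intro p _
    rw [← Finset.sum_filter, Finset.sum_const, nsmul_eq_mul, mul_one]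
    have h := LevelOne.card_sites_le' hA hI p (by norm_num : (0 : ℝ) ≤ 11 / 10) (F.filter (fun q => p ≠ q ∧ dist p q ≤ 11 / 10))
      (fun s hs => by
        rw [Finset.mem_filter] at hs
        exact ⟨(hmemF s hs.1).1, by rw [dist_comm]; exact hs.2.2⟩)
    refine h.trans ?_
    norm_num
  calc NN[(fun x => χ x • u x), c, R]
      ≤ ∑ p ∈ F, ∑ q ∈ F, (2 * ((11 / 10) / w) ^ 2 * ((if p ≠ q ∧ dist p q ≤ 11 / 10 then (1 : ℝ) else 0) * ‖u p‖ ^ 2) +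
          2 * (if p ≠ q ∧ dist p q ≤ 11 / 10 then ‖u p - u q‖ ^ 2 else (0 : ℝ))) :=
        Finset.sum_le_sum fun p hp => Finset.sum_le_sum fun q hq => hpt p hp q hq
    _ = 2 * ((11 / 10) / w) ^ 2 * ∑ p ∈ F, (∑ q ∈ F, (if p ≠ q ∧ dist p q ≤ 11 / 10 then (1 : ℝ) else 0)) * ‖u p‖ ^ 2 +
        2 * NN[u, c, R] := by
        rw [show (∑ p ∈ F, ∑ q ∈ F, (2 * ((11 / 10) / w) ^ 2 * ((if p ≠ q ∧ dist p q ≤ 11 / 10 then (1 : ℝ) else 0) * ‖u p‖ ^ 2) +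
          2 * (if p ≠ q ∧ dist p q ≤ 11 / 10 then ‖u p - u q‖ ^ 2 else (0 : ℝ)))) =
          ∑ p ∈ F, ((∑ q ∈ F, 2 * ((11 / 10) / w) ^ 2 * ((if p ≠ q ∧ dist p q ≤ 11 / 10 then (1 : ℝ) else 0) * ‖u p‖ ^ 2)) +
            ∑ q ∈ F, 2 * (if p ≠ q ∧ dist p q ≤ 11 / 10 then ‖u p - u q‖ ^ 2 else (0 : ℝ))) from
          Finset.sum_congr rfl fun p _ => Finset.sum_add_distrib, Finset.sum_add_distrib, Finset.mul_sum, Finset.mul_sum]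
        congr 1
        · refine Finset.sum_congr rfl fun p _ => ?_
          rw [Finset.sum_mul, Finset.mul_sum]
        · exact Finset.sum_congr rfl fun p _ => by rw [Finset.mul_sum]
    _ ≤ 2 * ((11 / 10) / w) ^ 2 * ∑ p ∈ F, 40 * ‖u p‖ ^ 2 + 2 * NN[u, c, R] := by
        gcongr with p hp
        exact hcount p hp
    _ = _ := by rw [← Finset.mul_sum]; ring

end

end Summit.AtomisticToContinuum.Crystallization.Theorems.ExcessDecayLiouville

end
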